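import Summits.BirchSwinnertonDyer.Rank1Residual.Partition.Corners
import Summits.BirchSwinnertonDyer.Rank1Residual.Partition.CornersCM
import HarnessLib

/-!
# The strong partial theorem for ALL curves (CM axis folded in): RESIDUAL-MAP.md §A/§B/§C/§F corner
# predicates as one kernel statement (cell `b2b-bsdres`; coordinator ruling 2026-08-20T22:24Z)

HONEST FRAMING (run/shared/lean/b2b/bsd-rank1-residual/, verbatim in every file): the goal of the
cell is to DELETE the COMBINATION-SHAPED residual classes of the Birch–Swinnerton-Dyer formula for
ALL analytic-rank `≤ 1` elliptic curves over `ℚ` — "full BSD formula for every rank `≤ 1` curve in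
class `C`" assembled STRICTLY from published theorems — so that the rank-`≤ 1` remainder becomes
exactly the CONSTRUCTION-SHAPED classes, which are TYPED (missing-input `Prop`s), NOT attempted.
This is not "finishing BSD". No named fact is introduced; this file only combines
`Corners.bsdp_of_not_corner` / `bsdp_of_not_corner'` (rmap-1 gen 2: the eight corners X1 / X9 /
X10b / X6 ∧ r = 0 / X7 / X8 / X11a / X2; the primed form already carries no CM hypothesis) with
`CornersCM.bsdp_cm_of_not_cornerF` (rmap-3 gen 2: CM curves, the corner `CornerF`) — granted the
same fourteen named published facts of `Partition/Bsdp.lean`. (Source drafted by rmap-3 gen 2,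
`HOME/b2b-bsdres-rmap-3/g2/lean/CornersAll.lean`; filed by rmap-1 gen 3; the first form of rmap-3's draft coincides with `bsdp_of_not_corner'`
and is therefore not restated — see the section note below.)

THE STATEMENT: for every globally minimal elliptic `W/ℚ` of analytic rank `r ≤ 1` and every ODD
prime `p` with `p` good, or `p` multiplicative and `r = 0`, Miller's `BSD(E,p)` holds unless `(W, p)`
lies in one of the eight NON-CM corners — the CM axis contributes NO corner on this domain
(`CornerF` needs `p = 2` or a bad non-split prime; in rank `0` row C8 covers every prime):
`Corners.bsdp_of_not_corner'`. The form proved here, `bsdp_allCurves_of_not_corner_of_not_cornerF`,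
enlarges the domain by "or `W` has CM (any prime)" and reads the CM corner explicitly.

References: RESIDUAL-MAP.md §A/§B/§C/§F (CORNER PREDICATES), §I (HEADLINE DELIVERABLE);
`Partition/Corners.lean`, `Partition/CornersCM.lean`, `Partition/StrongPartial.lean`
(`bsdp_of_good_odd_of_not_corner`: the good-odd case with the seven-corner disjunction).
-/

namespace Summit.BirchSwinnertonDyer.Rank1Residual

open WeierstrassCurve Literature.NumberTheory.EllipticCurves
  Literature.NumberTheory.EllipticCurves.Rank1Residual Literature.NumberTheory.EllipticCurves.ModularForms
open scoped NumberField

section Curve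

variable {W : WeierstrassCurve ℚ} [W.IsElliptic] [W.IsGloballyMinimal] {p : ℕ} [Fact p.Prime]

/-! ### All curves: the headline with the CM axis folded in

The first form of the headline — every globally minimal `W/ℚ` of analytic rank `≤ 1`, every ODD `p`
with `p` good or (`p` multiplicative and `r = 0`), outside the eight non-CM corners ⇒ `BSDp W p`,
with NO CM hypothesis — is ALREADY the tree theorem `Corners.bsdp_of_not_corner'` (rmap-1 gen 2;
the CM case inside it goes through `bsdp_cm_of_good_or_mult_rankZero`). `CornersCM.lean`'s
docstring cites it under the name `bsdp_allCurves_of_not_corner`; read that name as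
`bsdp_of_not_corner'` (the gate's dedup rule forbids restating a landed theorem under a second
name). The theorem below is the ENLARGED-domain form with the CM corner explicit. -/

/-- **All curves, every prime, corner form with the CM corner explicit**: for `W/ℚ` of analytic
rank `≤ 1` and a prime `p` in the domain "`p` odd and (good, or multiplicative with `r = 0`)" OR
"`W` has CM" (any `p`), `BSD(E,p)` holds outside the eight non-CM corners (read only when `¬ cm`)
and outside `CornerF` (read only when `cm`). This is the union of `Corners.bsdp_of_not_corner` and
`bsdp_cm_of_not_cornerF` — the kernel form of "COVERED cells of §A/§B/§C/§F = the complement of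
the named corners" (RESIDUAL-MAP §I HEADLINE). [folklore] -/
theorem bsdp_allCurves_of_not_corner_of_not_cornerF
    (hSk : Skinner2016.thmC_padicValRat_bsd_rank_zero)
    (hBCS : BurungaleCastellaSkinner2025.cor131_padicValRat_bsd_rank_le_one)
    (hJSW : JetchevSkinnerWan2017.thm121_padicValRat_bsd_rank_one)
    (hCGS : CastellaGrossiSkinner2025.thmD_padicValRat_bsd_rank_le_one)
    (hGV : GreenbergVatsal2000.thm13_charIdeal_eq_of_gvPar) (hGr : greenberg_charValue_rankZero)
    (hmod : hasEntireLFunction_rat) (hmodP : nonempty_modularParametrizationData)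
    (hGZK : rank_eq_analyticRank_of_analyticRank_le_one)
    (hCM : bsdTriple_of_hasCM_of_L_one_ne_zero) (hKob : Kobayashi2013.cor14_bsdp_of_cm_rank_one)
    (hYZ : YanZhu2026.thm415_padicValRat_bsd_rank_le_one)
    (hW20 : Wuthrich2014.lemma20_surjective_threeAdic_of_semistable)
    (hLLT : LiLiuTian2024.thm11_bsdp_of_cm_rank_one)
    (hr : W.analyticRank ≤ 1)
    (hdom : W.HasCM ∨ (p ≠ 2 ∧ (Good W p ∨ (Mult W p ∧ W.analyticRank = 0))))
    (hA : ¬ W.HasCM → ¬ ClassX1 W p ∧ ¬ ClassX9 W p ∧ ¬ (ClassX10 W p ∧ ¬ Surj W p) ∧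
      ¬ (ClassX6 W p ∧ W.analyticRank = 0) ∧ ¬ ClassX7 W p ∧ ¬ ClassX8 W p ∧
      ¬ ClassX11a W p ∧ ¬ ClassX2 W p)
    (hF : W.HasCM → ¬ CornerF W p) : BSDp W p := by
  by_cases hcm : W.HasCM
  · exact bsdp_cm_of_not_cornerF hCM hmod hLLT hKob hcm hr (hF hcm)
  · rcases hdom with h | ⟨hp, hdom⟩
    · exact absurd h hcm
    · obtain ⟨hX1, hX9, hX10b, hX6, hX7, hX8, hX11a, hX2⟩ := hA hcm
      exact bsdp_of_not_corner hSk hBCS hJSW hCGS hGV hGr hmod hmodP hGZK hCM hKob hYZ hW20 hLLT hr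
        hcm hp hdom hX1 hX9 hX10b hX6 hX7 hX8 hX11a hX2

end Curve

end Summit.BirchSwinnertonDyer.Rank1Residual
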